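import Summits.BirchSwinnertonDyer.BirchSwinnertonDyer.Theses.UniversalToricDescent
import Summits.BirchSwinnertonDyer.BirchSwinnertonDyer.Theorems.UniversalToricDescentCharIdealOffTorsionUnitFrames
import HarnessLib

/-!
# What crux #2 and its transport child assert about `Λ`-torsion, BY NAME — statement audit (T11)
# for `ToricTransportModThree` (stmt-BirchSwinnertonDyer-20186) / `InvariantsTransportModThree` (20399)

Lead prover bsd-wall-utd-p1 g4 (`--supports stmt-BirchSwinnertonDyer-20399`, helper). By-name corollaries of
the route-free file `UniversalToricDescentCharIdealOffTorsionUnitFrames`: the items are taken AS HYPOTHESES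
(nothing is claimed about them) and read at a datum whose BDP/LZZ frame `L` of `f_E` is NOT a unit of `R₀⟦T⟧`
(`‖L(𝟙)‖ < 1`; by crux #4 this is `v₃(log_ω P/c) > 0`):

* `invariantsTransportModThree_isTorsion_of_not_isUnit` — child 20399 ⟹ `X_{∅,0}(E/K_∞)` (the tree's
  `AcSelmer.XAc (W.baseChange K) 3 κ 𝔭′ ∅ γ`) is a torsion `Λ`-module at every such datum;
* `toricTransportModThree_isTorsion_of_not_isUnit` — the parent crux 20186 ⟹ the same;
* `twin_isTorsion_of_forall_frame_eq_span_of_not_isUnit` — the parent's twin-side HYPOTHESIS "every frame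
  `L′` of `f_{E′}` generates `Ch_Λ(X_{∅,0}(E′/K_∞))·R₀⟦T⟧`" at a non-unit twin frame forces the twin's
  `X_{∅,0}` to be torsion (so where it is not, that hypothesis is false and 20186 holds vacuously).

Reading (prose, for the steward's pen; no statement is changed here): together with p543904 (child 20395 is
vacuous off the torsion locus) — the beyond-print `Λ`-torsion of `X_{∅,0}(E/K_∞)` at the additive split
prime is carried by 20399/20186 at non-unit frames and by no child at unit frames; the T11-clean repair is a
`Module.IsTorsion` conjunct in 20395's conclusion (BCS 2025 Thm 1.2.4 (b) shape).

THEOREMS ONLY; no definition, no named fact, no `sorry`. Imports the route file (by-name readings).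
References: [Castella2018] Thm. 2.3; [GreenbergVatsal2000] §1; [Washington1997] §13.2.
-/

noncomputable section

open scoped Classical

set_option linter.dupNamespace false
set_option autoImplicit false

namespace Summit.BirchSwinnertonDyer.BirchSwinnertonDyer.Theorems.UniversalToricDescentOffTorsionUnitFrames

open Literature.NumberTheory.EllipticCurves NumberField IsDedekindDomain Field
  Summit.BirchSwinnertonDyer.Rank1Residual.X11b
  Summit.BirchSwinnertonDyer.BirchSwinnertonDyer.Theses.UniversalToricDescent

/-- **Child 20399 ⟹ `Λ`-torsion of `X_{∅,0}(E/K_∞)` at every datum with a non-unit frame.** The item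
`InvariantsTransportModThree` is a HYPOTHESIS here; its conclusion at a frame `L ∉ R₀⟦T⟧ˣ` is impossible when
`Ch_Λ(X_{∅,0}) = ⊤`, i.e. off the torsion locus (`exists_generator_normProfile_top_iff_isUnit` +
`UniversalToricDescentCharIdealVacuity.charIdeal_eq_top_of_not_isTorsion`).
[cite: GreenbergVatsal2000, §1 (the (μ, λ) currency)]
[cite: Castella2018, Thm. 2.3 (arXiv:1704.06608 p. 5) (the torsion hypothesis behind Ch_Λ(X_ac))] -/
theorem invariantsTransportModThree_isTorsion_of_not_isUnit (hI : InvariantsTransportModThree) :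
  ∀ (W : WeierstrassCurve ℚ) [W.IsElliptic] [W.IsGloballyMinimal]
    (W' : WeierstrassCurve ℚ) [W'.IsElliptic] [W'.IsGloballyMinimal]
    (N N' : ℕ) [NeZero N] [NeZero N'] (K : Type) [Field K] [NumberField K]
    (Dt : Literature.NumberTheory.EllipticCurves.ModularForms.ModularParametrizationData W N)
    (Dt' : Literature.NumberTheory.EllipticCurves.ModularForms.ModularParametrizationData W' N'),
    Summit.BirchSwinnertonDyer.Rank1Residual.Additive.ClassO6 W 3 → W.HasSurjectiveModNGaloisRep 3 →
    W.analyticRank = 1 → W.conductorNorm ℤ = N →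
    Summit.BirchSwinnertonDyer.Rank1Residual.O6.ModPCongruent W' W 3 →
    ¬ Literature.NumberTheory.EllipticCurves.Rank1Residual.Addv W' 3 → W'.conductorNorm ℤ = N' →
    Literature.NumberTheory.EllipticCurves.IsImaginaryQuadratic K →
    Literature.NumberTheory.EllipticCurves.SatisfiesHeegnerHypothesis N K →
    Literature.NumberTheory.EllipticCurves.SatisfiesHeegnerHypothesis N' K →
    ∀ (κ : Literature.NumberTheory.EllipticCurves.ZpExtension K 3), κ.IsAnticyclotomic →
      ∀ (γ : Field.absoluteGaloisGroup K) [Fact (κ.IsTopGenerator γ)]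
        (𝔭 : IsDedekindDomain.HeightOneSpectrum (NumberField.RingOfIntegers K)),
        ((3 : ℕ) : NumberField.RingOfIntegers K) ∈ 𝔭.asIdeal →
        𝔭.asIdeal.ramificationIdx (NumberField.RingOfIntegers ℚ) = 1 →
        𝔭.asIdeal.inertiaDeg (NumberField.RingOfIntegers ℚ) = 1 →
        ∀ (𝔭' : IsDedekindDomain.HeightOneSpectrum (NumberField.RingOfIntegers K)),
        ((3 : ℕ) : NumberField.RingOfIntegers K) ∈ 𝔭'.asIdeal → 𝔭' ≠ 𝔭 →
        ∀ (ι' : PadicAlgCl 3 ≃+* ℂ),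
          Summit.BirchSwinnertonDyer.BirchSwinnertonDyer.Theorems.SchneiderFree.BranchInducesPrime 3 ι' 𝔭 →
          (∃ (ΩK : ℂ) (Ωp : ℂ_[3]) (L' : Literature.NumberTheory.EllipticCurves.UnrSeries 3),
              ΩK ≠ 0 ∧ Ωp ≠ 0 ∧ Literature.NumberTheory.EllipticCurves.IsBDPLFunction ι' 𝔭 κ γ Dt'.f ΩK Ωp L') →
          (∀ (ΩK : ℂ) (Ωp : ℂ_[3]) (L' : Literature.NumberTheory.EllipticCurves.UnrSeries 3), ΩK ≠ 0 → Ωp ≠ 0 →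
              Literature.NumberTheory.EllipticCurves.IsBDPLFunction ι' 𝔭 κ γ Dt'.f ΩK Ωp L' →
              (AcSelmer.XAc.charIdeal (W'.baseChange K) 3 κ 𝔭' ∅ γ).map
                (PowerSeries.map (Halves.toUnr 3)) = Ideal.span {L'}) →
          (∀ (ΩK : ℂ) (Ωp : ℂ_[3]) (L' : Literature.NumberTheory.EllipticCurves.UnrSeries 3), ΩK ≠ 0 → Ωp ≠ 0 →
              Literature.NumberTheory.EllipticCurves.IsBDPLFunction ι' 𝔭 κ γ Dt'.f ΩK Ωp L' →
              ∃ i : ℕ, ‖((PowerSeries.coeff i L' : Literature.NumberTheory.EllipticCurves.unrIntegers 3) :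
                ℂ_[3])‖ = 1) →
          ∀ (ΩK : ℂ) (Ωp : ℂ_[3]) (L : Literature.NumberTheory.EllipticCurves.UnrSeries 3), ΩK ≠ 0 → Ωp ≠ 0 →
            Literature.NumberTheory.EllipticCurves.IsBDPLFunction ι' 𝔭 κ γ Dt.f ΩK Ωp L → ¬ IsUnit L →
            Module.IsTorsion (IwasawaAlgebra 3) (AcSelmer.XAc (W.baseChange K) 3 κ 𝔭' ∅ γ) := by
  intro W _ _ W' _ _ N N' _ _ K _ _ Dt Dt' hO6 honto hr hN hcong haddv hN' hK hH hH' κ hκ γ _ 𝔭 h𝔭 he hf 𝔭'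
    h𝔭' hne ι' hι' hex heq' hμ' ΩK Ωp L hΩK hΩp hL hLu
  by_contra hT
  have h := hI W W' N N' K Dt Dt' hO6 honto hr hN hcong haddv hN' hK hH hH' κ hκ γ 𝔭 h𝔭 he hf 𝔭' h𝔭' hne ι'
    hι' hex heq' hμ' ΩK Ωp L hΩK hΩp hL
  rw [show AcSelmer.XAc.charIdeal (W.baseChange K) 3 κ 𝔭' ∅ γ = ⊤ from
      UniversalToricDescentCharIdealVacuity.charIdeal_eq_top_of_not_isTorsion hT, Ideal.map_top] at h
  exact hLu ((exists_generator_normProfile_top_iff_isUnit L).mp h)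

/-- **Crux #2 (20186) ⟹ `Λ`-torsion of `X_{∅,0}(E/K_∞)` at every datum with a non-unit frame** (its
conclusion `Ch·R₀⟦T⟧ = (L)` with `L ∉ R₀⟦T⟧ˣ` forces `Ch ≠ ⊤`; `top_eq_span_singleton_iff_isUnit`).
The crux is a HYPOTHESIS here. [cite: Castella2018, Thm. 2.3 (arXiv:1704.06608 p. 5) (the torsion hypothesis behind Ch_Λ(X_ac))] -/
theorem toricTransportModThree_isTorsion_of_not_isUnit (hT : ToricTransportModThree) :
  ∀ (W : WeierstrassCurve ℚ) [W.IsElliptic] [W.IsGloballyMinimal]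
    (W' : WeierstrassCurve ℚ) [W'.IsElliptic] [W'.IsGloballyMinimal]
    (N N' : ℕ) [NeZero N] [NeZero N'] (K : Type) [Field K] [NumberField K]
    (Dt : Literature.NumberTheory.EllipticCurves.ModularForms.ModularParametrizationData W N)
    (Dt' : Literature.NumberTheory.EllipticCurves.ModularForms.ModularParametrizationData W' N'),
    Summit.BirchSwinnertonDyer.Rank1Residual.Additive.ClassO6 W 3 → W.HasSurjectiveModNGaloisRep 3 →
    W.analyticRank = 1 → W.conductorNorm ℤ = N →
    Summit.BirchSwinnertonDyer.Rank1Residual.O6.ModPCongruent W' W 3 →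
    ¬ Literature.NumberTheory.EllipticCurves.Rank1Residual.Addv W' 3 → W'.conductorNorm ℤ = N' →
    Literature.NumberTheory.EllipticCurves.IsImaginaryQuadratic K →
    Literature.NumberTheory.EllipticCurves.SatisfiesHeegnerHypothesis N K →
    Literature.NumberTheory.EllipticCurves.SatisfiesHeegnerHypothesis N' K →
    ∀ (κ : Literature.NumberTheory.EllipticCurves.ZpExtension K 3), κ.IsAnticyclotomic →
      ∀ (γ : Field.absoluteGaloisGroup K) [Fact (κ.IsTopGenerator γ)]
        (𝔭 : IsDedekindDomain.HeightOneSpectrum (NumberField.RingOfIntegers K)),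
        ((3 : ℕ) : NumberField.RingOfIntegers K) ∈ 𝔭.asIdeal →
        𝔭.asIdeal.ramificationIdx (NumberField.RingOfIntegers ℚ) = 1 →
        𝔭.asIdeal.inertiaDeg (NumberField.RingOfIntegers ℚ) = 1 →
        ∀ (𝔭' : IsDedekindDomain.HeightOneSpectrum (NumberField.RingOfIntegers K)),
        ((3 : ℕ) : NumberField.RingOfIntegers K) ∈ 𝔭'.asIdeal → 𝔭' ≠ 𝔭 →
        ∀ (ι' : PadicAlgCl 3 ≃+* ℂ),
          Summit.BirchSwinnertonDyer.BirchSwinnertonDyer.Theorems.SchneiderFree.BranchInducesPrime 3 ι' 𝔭 →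
          (∃ (ΩK : ℂ) (Ωp : ℂ_[3]) (L' : Literature.NumberTheory.EllipticCurves.UnrSeries 3),
              ΩK ≠ 0 ∧ Ωp ≠ 0 ∧ Literature.NumberTheory.EllipticCurves.IsBDPLFunction ι' 𝔭 κ γ Dt'.f ΩK Ωp L') →
          (∀ (ΩK : ℂ) (Ωp : ℂ_[3]) (L' : Literature.NumberTheory.EllipticCurves.UnrSeries 3), ΩK ≠ 0 → Ωp ≠ 0 →
              Literature.NumberTheory.EllipticCurves.IsBDPLFunction ι' 𝔭 κ γ Dt'.f ΩK Ωp L' →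
              (AcSelmer.XAc.charIdeal (W'.baseChange K) 3 κ 𝔭' ∅ γ).map
                (PowerSeries.map (Halves.toUnr 3)) = Ideal.span {L'}) →
          ∀ (ΩK : ℂ) (Ωp : ℂ_[3]) (L : Literature.NumberTheory.EllipticCurves.UnrSeries 3), ΩK ≠ 0 → Ωp ≠ 0 →
            Literature.NumberTheory.EllipticCurves.IsBDPLFunction ι' 𝔭 κ γ Dt.f ΩK Ωp L → ¬ IsUnit L →
            Module.IsTorsion (IwasawaAlgebra 3) (AcSelmer.XAc (W.baseChange K) 3 κ 𝔭' ∅ γ) := by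
  intro W _ _ W' _ _ N N' _ _ K _ _ Dt Dt' hO6 honto hr hN hcong haddv hN' hK hH hH' κ hκ γ _ 𝔭 h𝔭 he hf 𝔭'
    h𝔭' hne ι' hι' hex heq' ΩK Ωp L hΩK hΩp hL hLu
  by_contra hnT
  have h := hT W W' N N' K Dt Dt' hO6 honto hr hN hcong haddv hN' hK hH hH' κ hκ γ 𝔭 h𝔭 he hf 𝔭' h𝔭' hne ι'
    hι' hex heq' ΩK Ωp L hΩK hΩp hL
  rw [show AcSelmer.XAc.charIdeal (W.baseChange K) 3 κ 𝔭' ∅ γ = ⊤ from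
      UniversalToricDescentCharIdealVacuity.charIdeal_eq_top_of_not_isTorsion hnT, Ideal.map_top] at h
  exact hLu ((top_eq_span_singleton_iff_isUnit L).mp h)

/-- **The twin-side HYPOTHESIS of crux #2 at a non-unit twin frame forces the twin's `X_{∅,0}` to be
torsion**: if every frame `L′` of `f` at `(ι′, 𝔭)` satisfies `Ch_Λ(X_{∅,0}(E′/K_∞))·R₀⟦T⟧ = (L′)` and some
frame is not a unit, then `X_{∅,0}(E′/K_∞)` is `Λ`-torsion. Where it is not, the hypothesis is false and the
crux holds vacuously at that datum. Any prime `p`, any curve `W′/K`, any `Σ`.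
[cite: Castella2018, Thm. 2.3 (arXiv:1704.06608 p. 5) (the torsion hypothesis behind Ch_Λ(X_ac))] -/
theorem twin_isTorsion_of_forall_frame_eq_span_of_not_isUnit {K : Type} [Field K] [NumberField K]
    (W' : WeierstrassCurve K) (p : ℕ) [Fact p.Prime] (κ : ZpExtension K p)
    (𝔭' : HeightOneSpectrum (𝓞 K)) (S : Set (HeightOneSpectrum (𝓞 K)))
    (γ : Field.absoluteGaloisGroup K) [Fact (κ.IsTopGenerator γ)] {N' : ℕ}
    (ι' : PadicAlgCl p ≃+* ℂ) (𝔭 : HeightOneSpectrum (𝓞 K)) (f : CuspForm (CongruenceSubgroup.Gamma0 N') 2)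
    (heq' : ∀ (ΩK : ℂ) (Ωp : ℂ_[p]) (L' : UnrSeries p), ΩK ≠ 0 → Ωp ≠ 0 →
      IsBDPLFunction ι' 𝔭 κ γ f ΩK Ωp L' →
      (AcSelmer.XAc.charIdeal W' p κ 𝔭' S γ).map (PowerSeries.map (Halves.toUnr p)) = Ideal.span {L'})
    {ΩK : ℂ} {Ωp : ℂ_[p]} {L' : UnrSeries p} (hΩK : ΩK ≠ 0) (hΩp : Ωp ≠ 0)
    (hL' : IsBDPLFunction ι' 𝔭 κ γ f ΩK Ωp L') (hLu : ¬ IsUnit L') :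
    Module.IsTorsion (IwasawaAlgebra p) (AcSelmer.XAc W' p κ 𝔭' S γ) := by
  by_contra hnT
  have h := heq' ΩK Ωp L' hΩK hΩp hL'
  rw [show AcSelmer.XAc.charIdeal W' p κ 𝔭' S γ = ⊤ from
      UniversalToricDescentCharIdealVacuity.charIdeal_eq_top_of_not_isTorsion hnT, Ideal.map_top] at h
  exact hLu ((top_eq_span_singleton_iff_isUnit L').mp h)

end Summit.BirchSwinnertonDyer.BirchSwinnertonDyer.Theorems.UniversalToricDescentOffTorsionUnitFrames

end
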